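import Summits.QuantumAdvantage.AdviceFreeQNC0.TensorBlockFamily
import Summits.QuantumAdvantage.AdviceFreeQNC0.RankFormCover
import HarnessLib

/-!
# Cell qa-qnc0 (rung F-Q1, route RingFrame, crux α, line `tensor`): `UnionBound` and `RankBound` are
# FALSE (planner qa-qnc0-p2 gen 4, `S1-REFUTED.md` COROLLARY B, asks N-1 / N-3)

With the block family of `TensorBlockFamily.lean` (`L = n`, `L' = 2n`, `d = n − 2`,
`w = 2^{n+1} − 1 < 2^{L'−d}/2`):

* `card_filter_ldr_le : rowDist Xf Yf u = |a_u| ≤ 2^{n+1} − 1` — every row of `X` is `w`-close to its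
  degree-`(n−2)` decoding `Y`, STRICTLY inside the unique-decoding radius;
* `colDiff_eq_univ : colDiff Xf Yf = univ` (`n ≥ 2`) — the leaders cover ALL `4^n` columns;
* `not_unionBound : ¬ UnionBound` (N-1): `UnionBound` would give `4^n ≤ K·(2^{n+1} − 1)` for every `n`;
* `not_rankBound : ¬ RankBound` (N-3, via `unionBound_of_rankBound`, p467367): qn-p2's CONJECTURE R
  (bounded coboundary rank of the leader matrix) is false as well.

So the rank-form / union-bound road to S1 of the tensor line (qn-p2 ROUND-3 §2) is CLOSED in the
kernel.  WHAT THIS IS NOT: `LiftOneStrict` (S1 itself) needs the lift-cost lower bound of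
S1-REFUTED THEOREM A(5) (not in this file); `LiftOneStrictLog` (S1'), `TRPlus`, α and the separation
are untouched.
-/

namespace Summit.QuantumAdvantage.AdviceFreeQNC0

namespace TensorBlock

open Finset
open Literature.Computability.MetaComplexity Literature.Computability.MetaComplexity.Smolensky

variable {n : ℕ}

/-! ### Counting along the product structure `v = (q, r)` -/

/-- The `Q`-part of `(q, r)`. -/
theorem qp_append (q r : Fin n → Bool) : qp (Fin.append q r) = q := by
  funext i; unfold qp; rw [Fin.append_left]

/-- The `R`-part of `(q, r)`. -/
theorem rp_append (q r : Fin n → Bool) : rp (Fin.append q r) = r := by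
  funext i; unfold rp; rw [Fin.append_right]

/-- Every column index is `(q, r)`. -/
theorem append_qp_rp (v : Fin (n + n) → Bool) : Fin.append (qp v) (rp v) = v :=
  Fin.append_castAdd_natAdd

/-- The columns of the block `B_{q₀}` satisfying a condition on the `R`-part are counted in `R`. -/
theorem card_filter_block (q₀ : Fin n → Bool) (P : (Fin n → Bool) → Prop) [DecidablePred P] :
    ((univ : Finset (Fin (n + n) → Bool)).filter fun v => qp v = q₀ ∧ P (rp v)).card =
      ((univ : Finset (Fin n → Bool)).filter P).card := by
  symm
  refine Finset.card_bij (fun r _ => Fin.append q₀ r) ?_ ?_ ?_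
  · intro r hr
    rw [Finset.mem_filter] at hr ⊢
    exact ⟨Finset.mem_univ _, qp_append q₀ r, by rw [rp_append]; exact hr.2⟩
  · intro r₁ _ r₂ _ h
    have := congrArg rp h
    rwa [rp_append, rp_append] at this
  · intro v hv
    rw [Finset.mem_filter] at hv
    refine ⟨rp v, Finset.mem_filter.2 ⟨Finset.mem_univ _, hv.2.2⟩, ?_⟩
    rw [← hv.2.1]; exact append_qp_rp v

/-! ### Every row is `w`-light -/

/-- `rowDist X Y u = |a_u|`. -/
theorem rowDist_eq (u : Fin n → Bool) :
    rowDist Xf Yf u = ((univ : Finset (Fin (n + n) → Bool)).filter fun v => ldr u v = true).card := by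
  unfold rowDist
  congr 1
  refine Finset.filter_congr fun v _ => ?_
  unfold Yf
  cases Xf u v <;> cases ldr u v <;> decide

/-- **`|a_u| ≤ 2^{n+1} − 1`** (`= 2^{n+1} − |u|` for `u ≠ 0`, `= 0` for `u = 0`). -/
theorem rowDist_le (u : Fin n → Bool) : rowDist Xf Yf u ≤ 2 ^ (n + 1) - 1 := by
  classical
  rw [rowDist_eq]
  by_cases hu : u = (fun _ => false)
  · subst hu
    have : ((univ : Finset (Fin (n + n) → Bool)).filter fun v => ldr (fun _ => false) v = true) = ∅ := by
      rw [Finset.filter_eq_empty_iff]; intro v _; rw [ldr_zero]; decide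
    rw [this, Finset.card_empty]; exact Nat.zero_le _
  · obtain ⟨j, hj⟩ : ∃ j, u j = true := by
      by_contra h
      push Not at h
      exact hu (funext fun i => by simpa using h i)
    -- `supp a_u ⊆ B_u ∪ (B_0 ∖ {(0, e_j)})`
    have hsub : ((univ : Finset (Fin (n + n) → Bool)).filter fun v => ldr u v = true) ⊆
        ((univ : Finset (Fin (n + n) → Bool)).filter fun v => qp v = u ∧ True) ∪
          ((univ : Finset (Fin (n + n) → Bool)).filter fun v =>
            qp v = (fun _ => false) ∧ rp v ≠ basisRow j) := by
      intro v hv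
      rw [Finset.mem_filter] at hv
      rw [Finset.mem_union, Finset.mem_filter, Finset.mem_filter]
      by_cases hq : qp v = (fun _ => false)
      · right
        refine ⟨Finset.mem_univ _, hq, fun hr => ?_⟩
        have h := hv.2
        rw [ldr_of_qp_eq_zero hq hu] at h
        simp only [Bool.not_eq_true', decide_eq_false_iff_not, not_exists, not_and] at h
        exact h j hj hr
      · left
        have h := hv.2
        rw [ldr_of_qp_ne_zero hq] at h
        exact ⟨Finset.mem_univ _, of_decide_eq_true h, trivial⟩
    refine (Finset.card_le_card hsub).trans ((Finset.card_union_le _ _).trans ?_)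
    rw [card_filter_block u (fun _ => True), card_filter_block (fun _ => false) (fun r => r ≠ basisRow j),
      Finset.filter_true_of_mem (fun _ _ => trivial), Finset.card_univ, Fintype.card_fun, Fintype.card_bool,
      Fintype.card_fin,
      Finset.filter_ne' univ (basisRow j), Finset.card_erase_of_mem (Finset.mem_univ _), Finset.card_univ,
      Fintype.card_fun, Fintype.card_bool, Fintype.card_fin]
    have : 1 ≤ 2 ^ n := Nat.one_le_two_pow
    omega

/-! ### The leaders cover every column -/

/-- **`D₀ = ⋃ supp a_u = V`**: every column lies in some leader (`n ≥ 2`). -/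
theorem colDiff_eq_univ (hn : 2 ≤ n) : colDiff (Xf (n := n)) Yf = univ := by
  classical
  rw [Finset.eq_univ_iff_forall]
  intro v
  unfold colDiff
  rw [Finset.mem_filter]
  refine ⟨Finset.mem_univ _, ?_⟩
  -- `X u v ≠ Y u v ↔ a_u(v) = 1`
  suffices h : ∃ u, ldr u v = true by
    obtain ⟨u, hu⟩ := h
    refine ⟨u, ?_⟩
    unfold Yf; rw [hu]; cases Xf u v <;> decide
  by_cases hq : qp v = (fun _ => false)
  · have h1 : 1 < Fintype.card (Fin n) := by rw [Fintype.card_fin]; omega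
    by_cases hr : ∃ j, rp v = basisRow j
    · obtain ⟨j, hj⟩ := hr
      obtain ⟨k, hk⟩ := Fintype.exists_ne_of_one_lt_card h1 j
      refine ⟨basisRow k, ?_⟩
      rw [ldr_of_qp_eq_zero hq (basisRow_ne_zero k)]
      simp only [Bool.not_eq_true', decide_eq_false_iff_not, not_exists, not_and]
      intro j' hj' hr'
      have e1 : j' = k := by simpa [basisRow] using hj'
      have e2 : j = j' := basisRow_inj (hj.symm.trans hr')
      exact hk (e1 ▸ e2).symm
    · refine ⟨basisRow ⟨0, by omega⟩, ?_⟩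
      rw [ldr_of_qp_eq_zero hq (basisRow_ne_zero _)]
      simp only [Bool.not_eq_true', decide_eq_false_iff_not, not_exists, not_and]
      exact fun j' _ hr' => hr ⟨j', hr'⟩
  · exact ⟨qp v, by rw [ldr_of_qp_ne_zero hq]; simp⟩

/-! ### N-1 and N-3 -/

/-- **N-1: `UnionBound` is false.** -/
theorem not_unionBound : ¬ UnionBound := by
  rintro ⟨K, hK, h⟩
  obtain ⟨m, hm⟩ := pow_unbounded_of_one_lt K (by norm_num : (1 : ℝ) < 2)
  set n := m + 2 with hn
  have hn2 : 2 ≤ n := by omega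
  have hrad : 2 * (2 ^ (n + 1) - 1) < 2 ^ (n + n - (n - 2)) := by
    have e : n + n - (n - 2) = (n + 1) + 1 := by omega
    rw [e, pow_succ 2 (n + 1)]
    have : 1 ≤ 2 ^ (n + 1) := Nat.one_le_two_pow
    omega
  have hub := h n (n + n) (n - 2) (2 ^ (n + 1) - 1) hrad Xf Yf linCols_Xf rowsDeg_Yf rowDist_le
  rw [colDiff_eq_univ hn2, Finset.card_univ, Fintype.card_fun, Fintype.card_bool, Fintype.card_fin]
    at hub
  push_cast [Nat.one_le_two_pow] at hub
  -- `2^{2n} ≤ K (2^{n+1} − 1) < 2^m · 2^{n+1} ≤ 2^{2n}`: contradiction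
  have h2 : (0 : ℝ) < (2 : ℝ) ^ (n + 1) - 1 := by
    have : (2 : ℝ) ≤ (2 : ℝ) ^ (n + 1) := by
      calc (2 : ℝ) = 2 ^ 1 := by norm_num
        _ ≤ 2 ^ (n + 1) := pow_le_pow_right₀ (by norm_num) (by omega)
    linarith
  have h3 : K * ((2 : ℝ) ^ (n + 1) - 1) < (2 : ℝ) ^ m * (2 : ℝ) ^ (n + 1) := by
    calc K * ((2 : ℝ) ^ (n + 1) - 1) < (2 : ℝ) ^ m * ((2 : ℝ) ^ (n + 1) - 1) :=
          mul_lt_mul_of_pos_right hm h2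
      _ ≤ (2 : ℝ) ^ m * (2 : ℝ) ^ (n + 1) := mul_le_mul_of_nonneg_left (by linarith) (by positivity)
  have h4 : (2 : ℝ) ^ m * (2 : ℝ) ^ (n + 1) ≤ (2 : ℝ) ^ (n + n) := by
    rw [← pow_add]; exact pow_le_pow_right₀ (by norm_num) (by omega)
  linarith

/-- **N-3: `RankBound` (qn-p2 CONJECTURE R) is false.** -/
theorem not_rankBound : ¬ RankBound := fun h => not_unionBound (unionBound_of_rankBound h)

end TensorBlock

end Summit.QuantumAdvantage.AdviceFreeQNC0
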